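import Literature.NumberTheory.Weil1964.AdelicMetaplecticModulusNormalisation
import HarnessLib

/-!
# The wide-ray reduction step of Weil's boundedness theorem, in metaplectic currency

[Weil1965] n° 47 (Lemme 20) and n° 50 (proof of Thm. 4): a functional `E` on `𝒮(X_𝔸)` invariant under
the rational elements `r ∈ R` (`E ∘ ω(r⁻¹) = E`, `r` isometric) which is bounded — in the normalised
sense `|E(ω(q)Φ′)| ≤ M_B · L(q)^{1/2}` — on the GOOD set `q ∈ P_good` UNIFORMLY over the translated test
functions `Φ′ = ω(q_k)Φ`, `q_k ∈ Q` (a family of implementers of the compact part of the reduction, with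
moduli `L(q_k) ≥ c₁ > 0`), is bounded in the same normalised sense on EVERY `p` that reduction theory
writes as `p = r⁻¹ · q · k̃` with `π(k̃) = π(q_k)` for some `q_k ∈ Q`:
  `|E(ω(p)Φ)| ≤ (M_B / √c₁) · L(p)^{1/2}`.
Here `L = adelicMpCont.l2Scaling` is the `L²` modulus (the tree's Weil operators are not unitary:
`L(d(a)) = |det a|_𝔸`), `π = adelicMpCont.proj`, and the algebra is ★ `AdelicMetaplecticModulusNormalisation`
(`E(ω p Φ) = E(ω q (ω k̃ Φ))`, `ω k̃ Φ = t • ω q_k Φ`, `|t|² = L(k̃)/L(q_k)`, `L(k̃) = L(p)/L(q)`).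
* `omega_eq_smul_of_eq_mul_ofScalar` — `ω(q_k · (1,t)) Φ = t • ω(q_k) Φ` in `𝒮`;
* `norm_apply_omega_le_of_reduction` — ONE point: the bound at `p` from the bound at `(q, q_k)`;
* `norm_apply_omega_le_of_forall_reduction` — the quantified form consumed by the Siegel–Weil Borel
  bound (row SW2c-BOUND (C) of the Hodge-CM cell's sheet `SW2c-BOUND-ASSEMBLY.v0`, §3).
No reduction theory is PROVED here: the decomposition is a hypothesis (`hred`), supplied downstream by
`SL₂`/`U(1,1)` reduction (★ `SL2Reduction.exists_reduction` and its transport).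

References: A. Weil, *Sur la formule de Siegel dans la théorie des groupes classiques*, Acta Math. 113
(1965), n° 47 Lemme 20, n° 50 [Weil1965]; A. Weil, *Sur certains groupes d'opérateurs unitaires*, Acta
Math. 111 (1964), Chap. I n° 13 [Weil1964].
-/

noncomputable section

open _root_.MeasureTheory NumberField
open scoped ENNReal

namespace Literature.NumberTheory.Weil1964

open Literature.RepresentationTheory.HeisenbergGroup Literature.NumberTheory.Automorphic

variable (F : Type) [Field F] [NumberField F] {n : ℕ}
variable (T : Matrix (Fin n) (Fin n) (AdeleRing (𝓞 F) F)) (hT : IsUnit T.det)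
variable [MeasurableSpace (AdeleRing (𝓞 F) F)] [BorelSpace (AdeleRing (𝓞 F) F)]
variable (ν : Measure (Fin n → AdeleRing (𝓞 F) F)) [ν.IsAddHaarMeasure]

omit [MeasurableSpace (AdeleRing (𝓞 F) F)] [BorelSpace (AdeleRing (𝓞 F) F)] in
/-- `ω(q · (1, t·id)) Φ = t • ω(q) Φ` in `𝒮(𝔸_Fⁿ)`. [cite: Weil1964, Chap. I n° 13 p. 160] -/
theorem adelicMpCont.omega_eq_smul_of_eq_mul_ofScalar {q k : adelicMpCont F (Fin n) T} {t : ℂˣ}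
    (ht : k = q * adelicMpCont.ofScalar F (Fin n) T t) (Φ : piSchwartzBruhat F (Fin n)) :
    adelicMpCont.omega F (Fin n) T k Φ = (t : ℂ) • adelicMpCont.omega F (Fin n) T q Φ := by
  subst ht
  exact (adelicMpCont.omega_mul_apply F T q _ Φ).trans <|
    (congrArg (adelicMpCont.omega F (Fin n) T q) (adelicMpCont.omega_ofScalar (F := F) (T := T) t Φ)).trans
      (map_smul _ _ _)

/-- **The wide-ray reduction step, one point.** Let `E` be a linear functional on `𝒮(𝔸_Fⁿ)`, `Φ ∈ 𝒮`, and
`p = r⁻¹ q k̃`-data: `E ∘ ω(r⁻¹) = E`, `L(r) = 1`, an implementer `q_k` with `π(q⁻¹ r p) = π(q_k)` and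
`0 < c₁ ≤ L(q_k)`, and the good-set bound `‖E(ω q (ω q_k Φ))‖ ≤ M_B · L(q)^{1/2}`. Then
`‖E(ω p Φ)‖ ≤ (M_B / √c₁) · L(p)^{1/2}`. [cite: Weil1965, n° 47 Lemme 20 and n° 50] -/
theorem norm_apply_omega_le_of_reduction (E : piSchwartzBruhat F (Fin n) →ₗ[ℂ] ℂ) (Φ : piSchwartzBruhat F (Fin n))
    (p q r qk : adelicMpCont F (Fin n) T) (hE : E ∘ₗ adelicMpCont.omega F (Fin n) T r⁻¹ = E)
    (hr : adelicMpCont.l2Scaling F T hT ν r = 1)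
    (hproj : adelicMpCont.proj F (Fin n) T (q⁻¹ * r * p) = adelicMpCont.proj F (Fin n) T qk)
    {c₁ M_B : ℝ} (hc₁ : 0 < c₁) (hqk : c₁ ≤ (adelicMpCont.l2Scaling F T hT ν qk).toReal)
    (hB : ‖E (adelicMpCont.omega F (Fin n) T q (adelicMpCont.omega F (Fin n) T qk Φ))‖ ≤
      M_B * Real.sqrt (adelicMpCont.l2Scaling F T hT ν q).toReal) :
    ‖E (adelicMpCont.omega F (Fin n) T p Φ)‖ ≤
      M_B / Real.sqrt c₁ * Real.sqrt (adelicMpCont.l2Scaling F T hT ν p).toReal := by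
  have hLq0 : 0 < (adelicMpCont.l2Scaling F T hT ν q).toReal :=
    ENNReal.toReal_pos (adelicMpCont.l2Scaling_ne_zero F T hT ν q) (adelicMpCont.l2Scaling_ne_top F T hT ν q)
  have hLqk0 : 0 < (adelicMpCont.l2Scaling F T hT ν qk).toReal :=
    ENNReal.toReal_pos (adelicMpCont.l2Scaling_ne_zero F T hT ν qk) (adelicMpCont.l2Scaling_ne_top F T hT ν qk)
  have hLp0 : 0 ≤ (adelicMpCont.l2Scaling F T hT ν p).toReal := ENNReal.toReal_nonneg
  have hMB : 0 ≤ M_B := by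
    by_contra h
    have h' : M_B * Real.sqrt (adelicMpCont.l2Scaling F T hT ν q).toReal < 0 :=
      mul_neg_of_neg_of_pos (lt_of_not_ge h) (Real.sqrt_pos.2 hLq0)
    exact absurd (hB.trans_lt h') (not_lt.2 (norm_nonneg _))
  -- the lift `k̃ = q⁻¹ r p` is `qk · (1, t)`
  refine (adelicMpCont.exists_eq_mul_ofScalar_of_proj_eq F T hT qk (q⁻¹ * r * p) hproj.symm).elim fun t ht => ?_
  -- `E(ω p Φ) = t * E(ω q (ω qk Φ))`
  have h1 : E (adelicMpCont.omega F (Fin n) T p Φ) =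
      (t : ℂ) * E (adelicMpCont.omega F (Fin n) T q (adelicMpCont.omega F (Fin n) T qk Φ)) := by
    exact (adelicMpCont.apply_omega_eq_of_comp_omega_inv_eq F T E p q r hE Φ).trans <|
      (congrArg (fun Ψ => E (adelicMpCont.omega F (Fin n) T q Ψ))
        (adelicMpCont.omega_eq_smul_of_eq_mul_ofScalar F T ht Φ)).trans <|
        (congrArg E (LinearMap.map_smul (adelicMpCont.omega F (Fin n) T q) (t : ℂ) _)).trans
          (LinearMap.map_smul E (t : ℂ) _)
  -- `‖t‖ = √(L(p)/L(q)/L(qk))`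
  have hLk : adelicMpCont.l2Scaling F T hT ν (q⁻¹ * r * p) =
      adelicMpCont.l2Scaling F T hT ν p / adelicMpCont.l2Scaling F T hT ν q :=
    adelicMpCont.l2Scaling_inv_mul_mul_of_l2Scaling_eq_one F T hT ν p q r hr
  have ht2 : ‖(t : ℂ)‖ = Real.sqrt ((adelicMpCont.l2Scaling F T hT ν p).toReal /
      (adelicMpCont.l2Scaling F T hT ν q).toReal / (adelicMpCont.l2Scaling F T hT ν qk).toReal) := by
    rw [adelicMpCont.norm_eq_sqrt_div_of_eq_mul_ofScalar F T hT ν ht, hLk, ENNReal.toReal_div]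
  -- real-number endgame: `√(Lp/Lq/Lqk) · (M_B √Lq) = M_B √Lp / √Lqk ≤ M_B √Lp / √c₁`
  have key : ∀ {Lp Lq Lqk : ℝ}, 0 ≤ Lp → 0 < Lq → 0 < Lqk → c₁ ≤ Lqk → ∀ {x : ℝ}, x ≤ M_B * Real.sqrt Lq →
      Real.sqrt (Lp / Lq / Lqk) * x ≤ M_B / Real.sqrt c₁ * Real.sqrt Lp := by
    intro Lp Lq Lqk hp hq hqk hc x hx
    calc Real.sqrt (Lp / Lq / Lqk) * x ≤ Real.sqrt (Lp / Lq / Lqk) * (M_B * Real.sqrt Lq) :=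
          mul_le_mul_of_nonneg_left hx (Real.sqrt_nonneg _)
      _ = M_B * (Real.sqrt Lp / Real.sqrt Lqk) := by
          rw [Real.sqrt_div (div_nonneg hp hq.le), Real.sqrt_div hp]
          have hq' : Real.sqrt Lq ≠ 0 := (Real.sqrt_pos.2 hq).ne'
          field_simp
      _ ≤ M_B * (Real.sqrt Lp / Real.sqrt c₁) := by
          refine mul_le_mul_of_nonneg_left ?_ hMB
          exact div_le_div_of_nonneg_left (Real.sqrt_nonneg _) (Real.sqrt_pos.2 hc₁) (Real.sqrt_le_sqrt hc)
      _ = M_B / Real.sqrt c₁ * Real.sqrt Lp := by ring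
  exact ((congrArg norm h1).trans ((norm_mul _ _).trans (congrArg (· * _) ht2))).trans_le
    (key hLp0 hLq0 hLqk0 hqk hB)

/-- **The wide-ray reduction step, quantified** (the shape consumed by the Siegel–Weil Borel bound): let `P`
(all points), `G` (good points), `R` (rational, isometric, `E`-invariant elements) and `Q` (implementers of the
compact part, moduli in `[c₁, ∞)`, `c₁ > 0`) be subsets of `Mp`, with the REDUCTION hypothesis
`∀ p ∈ P, ∃ r ∈ R, ∃ q ∈ G, ∃ q_k ∈ Q, π(q⁻¹ r p) = π(q_k)` and the GOOD-SET bound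
`∀ q ∈ G, ∀ q_k ∈ Q, ‖E(ω q (ω q_k Φ))‖ ≤ M_B · L(q)^{1/2}`. Then `‖E(ω p Φ)‖ ≤ (M_B/√c₁) · L(p)^{1/2}` on all
of `P`. [cite: Weil1965, n° 47 Lemme 20 and n° 50] -/
theorem norm_apply_omega_le_of_forall_reduction (E : piSchwartzBruhat F (Fin n) →ₗ[ℂ] ℂ)
    (Φ : piSchwartzBruhat F (Fin n)) (P G R Q : Set (adelicMpCont F (Fin n) T))
    (hE : ∀ r ∈ R, E ∘ₗ adelicMpCont.omega F (Fin n) T r⁻¹ = E)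
    (hR : ∀ r ∈ R, adelicMpCont.l2Scaling F T hT ν r = 1)
    {c₁ M_B : ℝ} (hc₁ : 0 < c₁) (hQ : ∀ qk ∈ Q, c₁ ≤ (adelicMpCont.l2Scaling F T hT ν qk).toReal)
    (hred : ∀ p ∈ P, ∃ r ∈ R, ∃ q ∈ G, ∃ qk ∈ Q,
      adelicMpCont.proj F (Fin n) T (q⁻¹ * r * p) = adelicMpCont.proj F (Fin n) T qk)
    (hB : ∀ q ∈ G, ∀ qk ∈ Q, ‖E (adelicMpCont.omega F (Fin n) T q (adelicMpCont.omega F (Fin n) T qk Φ))‖ ≤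
      M_B * Real.sqrt (adelicMpCont.l2Scaling F T hT ν q).toReal) :
    ∀ p ∈ P, ‖E (adelicMpCont.omega F (Fin n) T p Φ)‖ ≤
      M_B / Real.sqrt c₁ * Real.sqrt (adelicMpCont.l2Scaling F T hT ν p).toReal := by
  intro p hp
  obtain ⟨r, hr, q, hq, qk, hqk, hproj⟩ := hred p hp
  exact norm_apply_omega_le_of_reduction F T hT ν E Φ p q r qk (hE r hr) (hR r hr) hproj hc₁ (hQ qk hqk) (hB q hq qk hqk)

end Literature.NumberTheory.Weil1964
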